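import Summits.AtomisticToContinuum.Crystallization.Theorems.OverbindingBudgetAffineFarFieldCellVoronoiFeed

/-!
# Overbinding budget — far-field Voronoi cells, part 27V-T «Collar»: generic tube lemmas

Route `OverbindingBudget`, crux `RobustDefectLimitWindows` (stmt-31280), line (2c), leaf SW♭(30),
part 27V, declared certificate shape (B2b) «tube/prism containment» for the INTERFACE row
`ρ((∫_{Uc₂} g) − ∫_{Uc₁} g)` (reference core union `Uc₁`, actual core union `Uc₂`).  ATLAS-FREE and
generic: nothing here knows the lattice, the chart atlas or the kernel.
* §1 (T0, T2) Voronoi cells of a LOCALLY FINITE atom set `Z` (every closed ball meets `Z` in a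
  finite set): every point has a nearest atom (`exists_mem_voronoiCell`, the cover
  `iUnion_voronoiCell_eq_univ`); unions of cells over any `W ⊆ Z` are closed
  (`isClosed_biUnion_voronoiCell`); each cell contains a ball about its atom
  (`exists_ball_subset_voronoiCell`); a cell outside the core `C` stays in the closure of the
  complement of the core union (`voronoiCell_subset_closure_compl`); the frontier of the core
  union lies in the core/non-core cell intersections = the COLLAR FACETS
  (`frontier_biUnion_voronoiCell_subset`).
* §2 (T3) crossing: a point outside `A` within `w` of a point of `A` is within `w` of `frontier A`
  (`mem_cthickening_frontier`); both halves of `Uc₁ ∆ Uc₂` lie in the `w`-tube of `frontier Uc₁`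
  under per-cell nearness hypotheses that the atlas supplies only where they are used
  (`sdiff_subset_cthickening_frontier`, `sdiff_subset_cthickening_frontier'`).
* §3 (T5) measure: `|(∫_B g) − ∫_A g| ≤ ∫_{A ∆ B} |g| ≤ Σ_F c_F · vol(P_F)` for a finite prism cover
  of the symmetric difference (`abs_setIntegral_sub_le_sum`).
* §4 (F3, DENSITY row under shape (B1a) sandwich-volume): `m ≤ ρV ≤ M`, `mM ≤ 1` ⇒
  `|V⁻¹ − ρ| ≤ ρ(m⁻¹ − 1)` (`density_coeff_le`, `density_coeff_le_sandwich`).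
The convention-bound items (T0′ lattice cell = ideal cell, T4 the explicit facet prism) and the
atlas input (T1) are separate parts.
-/

namespace Summit.AtomisticToContinuum.Crystallization.Theorems.OverbindingBudgetAffineFarFieldCollar

noncomputable section

open Set MeasureTheory Metric
open Literature.Barriers.AtomisticToContinuum (voronoiCell convex_voronoiCell isClosed_voronoiCell)
open Summit.AtomisticToContinuum.Crystallization.Theorems.OverbindingBudgetAffineFarFieldCellVoronoiFeed
  (aedisjoint_voronoiCell)

local notation "E3" => EuclideanSpace ℝ (Fin 3)

variable {Z : Set E3}

/-! ## §1 Locally finite atom sets: cover, closed unions, interior ball, frontier of a core union -/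

/-- support: if `y ∈ cell z` and `z₀ ∈ Z` then `dist z p ≤ 2·dist y p + dist p z₀`. [this file] -/
theorem dist_le_of_mem_voronoiCell {z z₀ y : E3} (hy : y ∈ voronoiCell Z z) (hz₀ : z₀ ∈ Z)
    (p : E3) : dist z p ≤ 2 * dist y p + dist p z₀ := by
  have h1 : dist y z ≤ dist y z₀ := hy z₀ hz₀
  have h2 := dist_triangle y p z₀
  have h3 := dist_triangle z y p
  rw [dist_comm z y] at h3
  linarith

/-- support (T0): in a locally finite nonempty atom set every point has a nearest atom. -/
theorem exists_mem_voronoiCell (hZ : ∀ (p : E3) (r : ℝ), (Z ∩ closedBall p r).Finite)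
    (hne : Z.Nonempty) (p : E3) : ∃ z ∈ Z, p ∈ voronoiCell Z z := by
  obtain ⟨z₀, hz₀⟩ := hne
  have hfin := hZ p (dist p z₀)
  obtain ⟨z, hz, hmin⟩ := hfin.toFinset.exists_min_image (fun z => dist p z)
    ⟨z₀, by simp [hz₀, mem_closedBall, dist_comm]⟩
  rw [Set.Finite.mem_toFinset] at hz
  refine ⟨z, hz.1, fun w hw => ?_⟩
  by_cases hwr : dist p w ≤ dist p z₀
  · exact hmin w (by
      rw [Set.Finite.mem_toFinset]
      exact ⟨hw, by rw [mem_closedBall, dist_comm]; exact hwr⟩)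
  · have hz' : dist p z ≤ dist p z₀ := by
      have h := hz.2
      rwa [mem_closedBall, dist_comm] at h
    exact hz'.trans (le_of_lt (lt_of_not_ge hwr))

/-- support (T0): the Voronoi cells of a locally finite nonempty atom set cover space. -/
theorem iUnion_voronoiCell_eq_univ (hZ : ∀ (p : E3) (r : ℝ), (Z ∩ closedBall p r).Finite)
    (hne : Z.Nonempty) : ⋃ z ∈ Z, voronoiCell Z z = univ := by
  refine eq_univ_of_forall fun p => ?_
  obtain ⟨z, hz, hp⟩ := exists_mem_voronoiCell hZ hne p
  exact mem_biUnion hz hp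

/-- support: a locally finite atom set is countable. [this file] -/
theorem countable_of_locallyFinite (hZ : ∀ (p : E3) (r : ℝ), (Z ∩ closedBall p r).Finite) :
    Z.Countable := by
  have h : Z ⊆ ⋃ n : ℕ, Z ∩ closedBall 0 n := by
    intro z hz
    obtain ⟨n, hn⟩ := exists_nat_ge (dist z 0)
    exact mem_iUnion.2 ⟨n, hz, mem_closedBall.2 hn⟩
  exact (countable_iUnion fun n : ℕ => (hZ 0 (n : ℝ)).countable).mono h

/-- support (T2): the union of the cells over ANY `W ⊆ Z` is closed (locally finite family). -/
theorem isClosed_biUnion_voronoiCell (hZ : ∀ (p : E3) (r : ℝ), (Z ∩ closedBall p r).Finite)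
    {W : Set E3} (hW : W ⊆ Z) : IsClosed (⋃ z ∈ W, voronoiCell Z z) := by
  rcases W.eq_empty_or_nonempty with rfl | ⟨z₀, hz₀W⟩
  · simp
  have hz₀ : z₀ ∈ Z := hW hz₀W
  have hlf : LocallyFinite (fun z : W => voronoiCell Z (z : E3)) := by
    intro x
    refine ⟨ball x 1, ball_mem_nhds x one_pos, ?_⟩
    have hfin : (Subtype.val ⁻¹' (Z ∩ closedBall x (2 * 1 + dist x z₀)) : Set W).Finite :=
      (hZ x _).preimage Subtype.val_injective.injOn
    refine hfin.subset fun z hz => ?_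
    obtain ⟨y, hyK, hyB⟩ := hz
    refine ⟨hW z.2, mem_closedBall.2 ?_⟩
    have h := dist_le_of_mem_voronoiCell hyK hz₀ x
    have hy1 : dist y x < 1 := mem_ball.1 hyB
    linarith
  rw [biUnion_eq_iUnion]
  exact hlf.isClosed_iUnion fun z => isClosed_voronoiCell Z z

/-- support: every atom of a locally finite set has a ball about it inside its own cell. -/
theorem exists_ball_subset_voronoiCell (hZ : ∀ (p : E3) (r : ℝ), (Z ∩ closedBall p r).Finite)
    {w : E3} (_hw : w ∈ Z) : ∃ ρ > 0, ball w ρ ⊆ voronoiCell Z w := by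
  -- a radius `ρ ≤ 1/2` with `2ρ ≤ dist w z` for every other atom `z`
  obtain ⟨ρ, hρ, hρ1, hsep⟩ : ∃ ρ > 0, ρ ≤ 1 / 2 ∧ ∀ z ∈ Z, z ≠ w → 2 * ρ ≤ dist w z := by
    have hfin : ((Z ∩ closedBall w 1) \ {w}).Finite := (hZ w 1).subset sdiff_subset
    rcases ((Z ∩ closedBall w 1) \ {w}).eq_empty_or_nonempty with h0 | hne
    · refine ⟨1 / 2, by norm_num, le_rfl, fun z hz hzw => ?_⟩
      by_contra hlt
      have hmem : z ∈ (Z ∩ closedBall w 1) \ {w} :=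
        ⟨⟨hz, mem_closedBall.2 (by rw [dist_comm]; linarith [lt_of_not_ge hlt])⟩, hzw⟩
      rw [h0] at hmem
      exact hmem
    · obtain ⟨z₁, hz₁, hmin⟩ := hfin.toFinset.exists_min_image (fun z => dist w z)
        (by simpa using hne)
      rw [Set.Finite.mem_toFinset] at hz₁
      have hd : 0 < dist w z₁ := dist_pos.2 (Ne.symm hz₁.2)
      refine ⟨min (1 / 2) (dist w z₁ / 2), lt_min (by norm_num) (by linarith), min_le_left _ _,
        fun z hz hzw => ?_⟩
      by_cases hz1 : dist w z ≤ 1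
      · have h := hmin z (by
          rw [Set.Finite.mem_toFinset]
          exact ⟨⟨hz, mem_closedBall.2 (by rwa [dist_comm])⟩, hzw⟩)
        have : min (1 / 2) (dist w z₁ / 2) ≤ dist w z₁ / 2 := min_le_right _ _
        linarith
      · have : min (1 / 2) (dist w z₁ / 2) ≤ 1 / 2 := min_le_left _ _
        linarith [lt_of_not_ge hz1]
  refine ⟨ρ, hρ, fun x hx z hz => ?_⟩
  have hxw : dist x w < ρ := mem_ball.1 hx
  by_cases hzw : z = w
  · rw [hzw]
  · have h := hsep z hz hzw
    have ht := dist_triangle w x z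
    rw [dist_comm w x] at ht
    linarith

/-- support (T2): a cell OUTSIDE the core `C` does not enter the interior of the core union — it is
contained in the closure of its complement (cells are convex with interior points and pairwise
a.e.-disjoint, and open balls have positive volume). [this file] -/
theorem voronoiCell_subset_closure_compl (hZ : ∀ (p : E3) (r : ℝ), (Z ∩ closedBall p r).Finite)
    {C : Set E3} (hC : C ⊆ Z) {w : E3} (hw : w ∈ Z) (hwC : w ∉ C) :
    voronoiCell Z w ⊆ closure (⋃ z ∈ C, voronoiCell Z z)ᶜ := by
  intro y hy
  by_contra hyc
  rw [closure_compl, mem_compl_iff, not_not] at hyc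
  obtain ⟨ε, hε, hball⟩ := Metric.isOpen_iff.1 isOpen_interior y hyc
  have hballU : ball y ε ⊆ ⋃ z ∈ C, voronoiCell Z z := hball.trans interior_subset
  obtain ⟨ρ, hρ, hρK⟩ := exists_ball_subset_voronoiCell hZ hw
  -- the ball about `c = y + t (w - y)` of radius `t ρ` lies in `cell w ∩ ball y ε`
  set D : ℝ := dist y w + ρ with hD
  have hDpos : 0 < D := by have := dist_nonneg (x := y) (y := w); linarith
  set t : ℝ := min (1 / 2) (ε / (2 * D)) with ht
  have htpos : 0 < t := lt_min (by norm_num) (div_pos hε (by linarith))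
  have ht1 : t ≤ 1 / 2 := min_le_left _ _
  have htD : t * D ≤ ε / 2 := by
    have h := min_le_right (1 / 2 : ℝ) (ε / (2 * D))
    calc t * D ≤ ε / (2 * D) * D := mul_le_mul_of_nonneg_right h hDpos.le
      _ = ε / 2 := by field_simp
  set c : E3 := y + t • (w - y) with hc
  have hsubK : ball c (t * ρ) ⊆ voronoiCell Z w := by
    intro x hx
    set b : E3 := w + t⁻¹ • (x - c) with hb
    have hbw : b ∈ ball w ρ := by
      rw [mem_ball, dist_eq_norm, hb, add_sub_cancel_left, norm_smul, norm_inv,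
        Real.norm_of_nonneg htpos.le]
      have hxc : ‖x - c‖ < t * ρ := by rw [← dist_eq_norm]; exact mem_ball.1 hx
      rw [inv_mul_lt_iff₀ htpos]
      linarith
    have hxeq : x = (1 - t) • y + t • b := by
      rw [hb, smul_add, smul_smul, mul_inv_cancel₀ htpos.ne', one_smul, hc]
      module
    rw [hxeq]
    exact convex_voronoiCell Z w hy (hρK hbw) (by linarith) htpos.le (by ring)
  have hsubU : ball c (t * ρ) ⊆ ball y ε := by
    intro x hx
    rw [mem_ball] at hx ⊢
    have hcy : dist c y = t * dist y w := by
      rw [dist_eq_norm, hc, add_sub_cancel_left, norm_smul, Real.norm_of_nonneg htpos.le,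
        dist_eq_norm, ← norm_neg (y - w), neg_sub]
    have h := dist_triangle x c y
    have : t * ρ + t * dist y w = t * D := by rw [hD]; ring
    linarith
  have hnull : volume (ball c (t * ρ)) = 0 := by
    have hsub : ball c (t * ρ) ⊆ ⋃ z ∈ C, voronoiCell Z w ∩ voronoiCell Z z := by
      intro x hx
      have hxU := hballU (hsubU hx)
      obtain ⟨z, hz, hxz⟩ := mem_iUnion₂.1 hxU
      exact mem_biUnion hz ⟨hsubK hx, hxz⟩
    refine measure_mono_null hsub ?_
    rw [measure_biUnion_null_iff ((countable_of_locallyFinite hZ).mono hC)]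
    intro z hz
    exact aedisjoint_voronoiCell hw (hC hz) (fun h => hwC (h ▸ hz))
  exact (measure_ball_pos volume c (mul_pos htpos hρ)).ne' hnull

/-- support (T2): the frontier of the core union lies in the COLLAR FACETS — the intersections of a
core cell with a non-core cell. [this file] -/
theorem frontier_biUnion_voronoiCell_subset
    (hZ : ∀ (p : E3) (r : ℝ), (Z ∩ closedBall p r).Finite) {C : Set E3} (hC : C ⊆ Z) :
    frontier (⋃ z ∈ C, voronoiCell Z z) ⊆
      ⋃ z ∈ C, ⋃ w ∈ Z \ C, voronoiCell Z z ∩ voronoiCell Z w := by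
  intro x hx
  have hU : IsClosed (⋃ z ∈ C, voronoiCell Z z) := isClosed_biUnion_voronoiCell hZ hC
  obtain ⟨z, hz, hxz⟩ := mem_iUnion₂.1 (hU.frontier_subset hx)
  have hne : Z.Nonempty := ⟨z, hC hz⟩
  have hxc : x ∈ closure (⋃ z ∈ C, voronoiCell Z z)ᶜ :=
    (frontier_eq_closure_inter_closure (s := ⋃ z ∈ C, voronoiCell Z z) ▸ hx).2
  have hcomp : (⋃ z ∈ C, voronoiCell Z z)ᶜ ⊆ ⋃ w ∈ Z \ C, voronoiCell Z w := by
    intro p hp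
    obtain ⟨w, hw, hpw⟩ := exists_mem_voronoiCell hZ hne p
    have hwC : w ∉ C := fun h => hp (mem_biUnion h hpw)
    exact mem_biUnion ⟨hw, hwC⟩ hpw
  have hW : IsClosed (⋃ w ∈ Z \ C, voronoiCell Z w) := isClosed_biUnion_voronoiCell hZ sdiff_subset
  obtain ⟨w, hw, hxw⟩ := mem_iUnion₂.1 ((hW.closure_subset_iff.2 hcomp) hxc)
  exact mem_biUnion hz (mem_biUnion hw ⟨hxz, hxw⟩)

/-! ## §2 Crossing: the symmetric difference of the core unions lies in a tube about the collar -/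

/-- support (T3): a point `x ∉ A` is within `dist x x'` of `frontier A` for any `x' ∈ A`. -/
theorem exists_mem_frontier_dist_le_of_notMem {A : Set E3} {x x' : E3} (hx : x ∉ A) (hx' : x' ∈ A) :
    ∃ y ∈ frontier A, dist x y ≤ dist x x' := by
  have hne : Aᶜ ≠ univ := fun h => (h.symm ▸ mem_univ x' : x' ∈ Aᶜ) hx'
  obtain ⟨y, hy, hyd⟩ := exists_mem_frontier_infDist_compl_eq_dist (mem_compl hx) hne
  rw [frontier_compl] at hy
  refine ⟨y, hy, ?_⟩
  rw [← hyd, compl_compl]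
  exact infDist_le_dist_of_mem hx'

/-- support (T3): `x ∈ A` is within `dist x x'` of `frontier A` for any `x' ∈ closure Aᶜ`. -/
theorem exists_mem_frontier_dist_le_of_mem_closure {A : Set E3} {x x' : E3} (hx : x ∈ A)
    (hx' : x' ∈ closure Aᶜ) : ∃ y ∈ frontier A, dist x y ≤ dist x x' := by
  have hne : A ≠ univ := fun h => by rw [h, compl_univ, closure_empty] at hx'; exact hx'
  obtain ⟨y, hy, hyd⟩ := exists_mem_frontier_infDist_compl_eq_dist hx hne
  refine ⟨y, hy, ?_⟩
  rw [← hyd, ← infDist_closure]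
  exact infDist_le_dist_of_mem hx'

/-- support (T3): hence within `w` of the frontier. -/
theorem mem_cthickening_frontier {A : Set E3} {x x' : E3} {w : ℝ} (hx : x ∉ A) (hx' : x' ∈ A)
    (hd : dist x x' ≤ w) : x ∈ cthickening w (frontier A) := by
  obtain ⟨y, hy, hyd⟩ := exists_mem_frontier_dist_le_of_notMem hx hx'
  exact mem_cthickening_of_dist_le x y w _ hy (hyd.trans hd)

/-- support (T3a): the part of the ACTUAL core union `⋃_{i ∈ C} K₂ i` outside the REFERENCE core
union `⋃_{i ∈ C} K₁ i` lies in the `w`-tube of the reference collar, given that every actual core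
cell point outside the reference union is within `w` of its own reference cell (the atlas supplies
this only for the collar-adjacent cells, where it is used). [this file] -/
theorem sdiff_subset_cthickening_frontier {ι : Type*} {C : Set ι} {K₁ K₂ : ι → Set E3} {w : ℝ}
    (h : ∀ i ∈ C, ∀ x ∈ K₂ i, x ∉ ⋃ j ∈ C, K₁ j → ∃ x' ∈ K₁ i, dist x x' ≤ w) :
    (⋃ i ∈ C, K₂ i) \ (⋃ i ∈ C, K₁ i) ⊆ cthickening w (frontier (⋃ i ∈ C, K₁ i)) := by
  rintro x ⟨hx2, hx1⟩
  obtain ⟨i, hi, hxi⟩ := mem_iUnion₂.1 hx2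
  obtain ⟨x', hx', hd⟩ := h i hi x hxi hx1
  exact mem_cthickening_frontier hx1 (mem_biUnion hi hx') hd

/-- support (T3b): the part of the REFERENCE core union outside the ACTUAL core union lies in the
`w`-tube of the reference collar, given that the actual cells cover space, that every point of an
actual NON-core cell inside the reference core union is within `w` of its own reference cell, and
that the reference non-core cells stay in the closure of the complement of the reference core union
(`voronoiCell_subset_closure_compl`). [this file] -/
theorem sdiff_subset_cthickening_frontier' {ι : Type*} {C : Set ι} {K₁ K₂ : ι → Set E3} {w : ℝ}
    (hcov : ⋃ i, K₂ i = univ)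
    (h : ∀ i ∉ C, ∀ x ∈ K₂ i, x ∈ ⋃ j ∈ C, K₁ j → ∃ x' ∈ K₁ i, dist x x' ≤ w)
    (hout : ∀ i ∉ C, (K₂ i ∩ ⋃ j ∈ C, K₁ j).Nonempty → K₁ i ⊆ closure (⋃ j ∈ C, K₁ j)ᶜ) :
    (⋃ i ∈ C, K₁ i) \ (⋃ i ∈ C, K₂ i) ⊆ cthickening w (frontier (⋃ i ∈ C, K₁ i)) := by
  rintro x ⟨hx1, hx2⟩
  obtain ⟨i, hxi⟩ := mem_iUnion.1 (hcov.symm ▸ mem_univ x : x ∈ ⋃ i, K₂ i)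
  have hi : i ∉ C := fun hi => hx2 (mem_biUnion hi hxi)
  obtain ⟨x', hx', hd⟩ := h i hi x hxi hx1
  have hx'c : x' ∈ closure (⋃ j ∈ C, K₁ j)ᶜ := hout i hi ⟨x, hxi, hx1⟩ hx'
  obtain ⟨y, hy, hyd⟩ := exists_mem_frontier_dist_le_of_mem_closure hx1 hx'c
  exact mem_cthickening_of_dist_le x y w _ hy (hyd.trans hd)

/-! ## §3 Measure: the interface integral is bounded through a prism cover of `Uc₁ ∆ Uc₂` -/

/-- support (T5): `|(∫_B g) − ∫_A g| ≤ ∫_{A ∆ B} |g|`. -/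
theorem abs_setIntegral_sub_le_symmDiff {A B : Set E3} {g : E3 → ℝ} (hA : MeasurableSet A)
    (hB : MeasurableSet B) (hgA : IntegrableOn g A) (hgB : IntegrableOn g B) :
    |(∫ x in B, g x) - ∫ x in A, g x| ≤ ∫ x in symmDiff A B, |g x| := by
  have hB' := integral_inter_add_sdiff₀ hA.nullMeasurableSet hgB
  have hA' := integral_inter_add_sdiff₀ hB.nullMeasurableSet hgA
  rw [inter_comm] at hA'
  have heq : (∫ x in B, g x) - ∫ x in A, g x = (∫ x in B \ A, g x) - ∫ x in A \ B, g x := by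
    linarith
  rw [heq, Set.symmDiff_def, setIntegral_union disjoint_sdiff_sdiff (hB.diff hA)
    (hgA.mono_set sdiff_subset).abs (hgB.mono_set sdiff_subset).abs]
  have h1 := abs_integral_le_integral_abs (f := g) (μ := volume.restrict (B \ A))
  have h2 := abs_integral_le_integral_abs (f := g) (μ := volume.restrict (A \ B))
  have h := abs_sub (∫ x in B \ A, g x) (∫ x in A \ B, g x)
  linarith

/-- support (T5): a set integral of a nonnegative function over a finite union is at most the sum
of the set integrals. [folklore; same statement as `Literature.NumberTheory.LFunctions.
BourgainBilinearReduction.setIntegral_biUnion_le_sum`, re-proved to keep the import cone geometric] -/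
theorem setIntegral_biUnion_le_sum_of_nonneg {ι : Type*} (I : Finset ι) (P : ι → Set E3) {h : E3 → ℝ}
    (hP : ∀ i ∈ I, MeasurableSet (P i)) (hh : ∀ i ∈ I, IntegrableOn h (P i))
    (h0 : ∀ x, 0 ≤ h x) : ∫ x in ⋃ i ∈ I, P i, h x ≤ ∑ i ∈ I, ∫ x in P i, h x := by
  classical
  induction I using Finset.induction_on with
  | empty => simp
  | insert a I ha ih =>
    have hP' : ∀ i ∈ I, MeasurableSet (P i) := fun i hi => hP i (Finset.mem_insert_of_mem hi)
    have hh' : ∀ i ∈ I, IntegrableOn h (P i) := fun i hi => hh i (Finset.mem_insert_of_mem hi)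
    have hU : MeasurableSet (⋃ i ∈ I, P i) := Finset.measurableSet_biUnion I hP'
    have hhU : IntegrableOn h (⋃ i ∈ I, P i) := integrableOn_finset_iUnion.2 hh'
    have hha : IntegrableOn h (P a) := hh a (Finset.mem_insert_self a I)
    rw [Finset.set_biUnion_insert, Finset.sum_insert ha, ← union_sdiff_self,
      setIntegral_union disjoint_sdiff_right (hU.diff (hP a (Finset.mem_insert_self a I))) hha
        (hhU.mono_set sdiff_subset)]
    have hmono : ∫ x in (⋃ i ∈ I, P i) \ P a, h x ≤ ∫ x in ⋃ i ∈ I, P i, h x :=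
      setIntegral_mono_set hhU (Filter.Eventually.of_forall fun x => h0 x)
        sdiff_subset.eventuallyLE
    linarith [ih hP' hh']

/-- support (T5): the INTERFACE bound — if `A ∆ B` is covered by finitely many prisms `P_F` on
which `|g| ≤ c_F`, then `|∫_B g − ∫_A g| ≤ Σ_F c_F · vol(P_F)`. [this file] -/
theorem abs_setIntegral_sub_le_sum {ι : Type*} {A B : Set E3} {g : E3 → ℝ} (I : Finset ι)
    (P : ι → Set E3) (c : ι → ℝ) (hA : MeasurableSet A) (hB : MeasurableSet B)
    (hgA : IntegrableOn g A) (hgB : IntegrableOn g B) (hP : ∀ i ∈ I, MeasurableSet (P i))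
    (hgP : ∀ i ∈ I, IntegrableOn g (P i)) (hfin : ∀ i ∈ I, volume (P i) < ⊤)
    (hsub : symmDiff A B ⊆ ⋃ i ∈ I, P i) (hc : ∀ i ∈ I, ∀ x ∈ P i, |g x| ≤ c i) :
    |(∫ x in B, g x) - ∫ x in A, g x| ≤ ∑ i ∈ I, c i * (volume (P i)).toReal := by
  have h1 := abs_setIntegral_sub_le_symmDiff hA hB hgA hgB
  have hgU : IntegrableOn (fun x => |g x|) (⋃ i ∈ I, P i) :=
    integrableOn_finset_iUnion.2 fun i hi => (hgP i hi).abs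
  have h2 : ∫ x in symmDiff A B, |g x| ≤ ∫ x in ⋃ i ∈ I, P i, |g x| :=
    setIntegral_mono_set hgU (Filter.Eventually.of_forall fun x => abs_nonneg (g x))
      hsub.eventuallyLE
  have h3 := setIntegral_biUnion_le_sum_of_nonneg I P hP (fun i hi => (hgP i hi).abs)
    (fun x => abs_nonneg (g x))
  have h4 : ∀ i ∈ I, ∫ x in P i, |g x| ≤ c i * (volume (P i)).toReal := by
    intro i hi
    have h := norm_setIntegral_le_of_norm_le_const (C := c i) (hfin i hi)
      (fun x hx => by rw [Real.norm_eq_abs, abs_abs]; exact hc i hi x hx)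
    rw [measureReal_def] at h
    exact (le_abs_self _).trans ((Real.norm_eq_abs _).symm.le.trans h)
  exact h1.trans (h2.trans (h3.trans (Finset.sum_le_sum h4)))

/-! ## §4 The DENSITY coefficient under the sandwich-volume shape (B1a) -/

/-- support (F3): if `m ≤ ρV ≤ M` with `0 < m`, `0 < ρ` and `mM ≤ 1`, then `|V⁻¹ − ρ| ≤ ρ(m⁻¹ − 1)`
(the upper deviation `1 − M⁻¹` is dominated because `m + M ≥ 2mM`). [this file] -/
theorem density_coeff_le {V ρ m M : ℝ} (hρ : 0 < ρ) (hm : 0 < m) (hlo : m ≤ ρ * V)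
    (hhi : ρ * V ≤ M) (hmM : m * M ≤ 1) : |V⁻¹ - ρ| ≤ ρ * (m⁻¹ - 1) := by
  have hx : 0 < ρ * V := hm.trans_le hlo
  have hV : 0 < V := pos_of_mul_pos_right hx hρ.le
  have hM : 0 < M := hx.trans_le hhi
  have hmi : m⁻¹ * m = 1 := inv_mul_cancel₀ hm.ne'
  have hkey : V⁻¹ - ρ = ρ * ((1 - ρ * V) / (ρ * V)) := by
    field_simp
  rw [hkey, abs_mul, abs_of_pos hρ]
  refine mul_le_mul_of_nonneg_left ?_ hρ.le
  rw [abs_le, le_div_iff₀ hx, div_le_iff₀ hx]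
  constructor
  · -- lower deviation: (2 − m⁻¹)·ρV ≤ 1, from ρV ≤ M and (2 − m⁻¹)M ≤ 1 ⟸ 2mM ≤ m + M ⟸ mM ≤ 1
    have h2 : 2 * (m * M) ≤ m + M := by
      nlinarith [sq_nonneg (m - M), mul_nonneg (mul_pos hm hM).le (sub_nonneg.2 hmM)]
    have key : (2 - m⁻¹) * M ≤ 1 := by
      have h := mul_le_mul_of_nonneg_left h2 (inv_nonneg.2 hm.le)
      have e1 : m⁻¹ * (2 * (m * M)) = 2 * M := by
        rw [← mul_assoc, ← mul_assoc, mul_comm m⁻¹ 2, mul_assoc 2, hmi, mul_one]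
      have e2 : m⁻¹ * (m + M) = 1 + m⁻¹ * M := by rw [mul_add, hmi]
      nlinarith [h, e1, e2]
    rcases le_or_gt 0 (2 - m⁻¹) with hpos | hneg
    · nlinarith [mul_le_mul_of_nonneg_left hhi hpos, key]
    · nlinarith [mul_neg_of_neg_of_pos hneg hx]
  · -- upper deviation: 1 − ρV ≤ (m⁻¹ − 1)·ρV, from m ≤ ρV i.e. 1 ≤ m⁻¹·ρV
    have h := mul_le_mul_of_nonneg_left hlo (inv_nonneg.2 hm.le)
    rw [hmi] at h
    nlinarith [h]

/-- support (F3, shape B1a): with the sandwich `(1−s)³ d V₀ ≤ V ≤ (1+s)³ d V₀` and the frame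
ledger `1 − δ ≤ ρ d V₀ ≤ 1 + δ` (so `m = (1−s)³(1−δ) ≤ ρV ≤ (1+s)³(1+δ) = M`, and `mM =
(1−s²)³(1−δ²) ≤ 1`), the density coefficient obeys `|V⁻¹ − ρ| ≤ ρ(((1−s)³(1−δ))⁻¹ − 1)`.
[this file] -/
theorem density_coeff_le_sandwich {V ρ s δ : ℝ} (hρ : 0 < ρ) (hs : 0 ≤ s) (hs1 : s < 1)
    (hδ : 0 ≤ δ) (hδ1 : δ < 1) (hlo : (1 - s) ^ 3 * (1 - δ) ≤ ρ * V)
    (hhi : ρ * V ≤ (1 + s) ^ 3 * (1 + δ)) :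
    |V⁻¹ - ρ| ≤ ρ * (((1 - s) ^ 3 * (1 - δ))⁻¹ - 1) := by
  have hm : 0 < (1 - s) ^ 3 * (1 - δ) := mul_pos (pow_pos (by linarith) 3) (by linarith)
  refine density_coeff_le hρ hm hlo hhi ?_
  have h1 : (1 - s) ^ 3 * (1 - δ) * ((1 + s) ^ 3 * (1 + δ)) = (1 - s ^ 2) ^ 3 * (1 - δ ^ 2) := by
    ring
  rw [h1]
  have h2 : (1 - s ^ 2) ^ 3 ≤ 1 := pow_le_one₀ (by nlinarith) (by nlinarith)
  have h3 : 1 - δ ^ 2 ≤ 1 := by nlinarith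
  have h4 : 0 ≤ 1 - δ ^ 2 := by nlinarith
  nlinarith [mul_le_mul h2 h3 h4 zero_le_one]

end

end Summit.AtomisticToContinuum.Crystallization.Theorems.OverbindingBudgetAffineFarFieldCollar
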